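import Summits.AnomalousDissipation.AnomalousDissipation.Theorems.SolenoidalFractalHomogenisationRealisedQuasiStaticCellLawSlavedLadderFast
import HarnessLib

/-!
# K2R `RealisedQuasiStaticCellLaw`, line `floquet-bloch`, stub `stub_lowSectorDecay` (S1D): the slaved-ladder Lyapunov
# functional (weak-coupling regime; per-window contraction with the second-order Taylor exponent)

Summits-side helper (everything proved; no definitions, no named facts; `--supports stmt-AnomalousDissipation-20446`).
Companion of brick (F2) `ladderFunctional_decay_intWindow` (file `…LadderFunctionalTridiagonal`) for the OPPOSITE regime:
F2 contracts the block energy of a three-term ladder `v_J' = −Λ(d_J v_J + g(t)(s_{J−1} v_{J−1} − s_J v_{J+1}))` on a window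
where the coupling stays in `[g_lo, g_hi]`, paying a fixed factor `5/3` per window; in the WEAK-coupling regime that factor
cannot be afforded once per period (cell `ad-ideate`, evidence #23 on 20446, tenure ruling 2026-08-27T19:5xZ: «the
constant must be paid ONCE, i.e. by a slaving argument»). Here the constant is paid once, in the prefactor:

* the functional is `Φ(t) = ‖v₀‖² + β·Σ_{J≠0} ‖v_J − h_J(t) v₀‖²` with the first-order slaving profile
  `h₁ = −g s₀/(d₁ − d₀)`, `h₋₁ = g s₋₁/(d₋₁ − d₀)`, `h_J = 0` otherwise (composite slow/fast Lyapunov function of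
  singular-perturbation theory, Saberi–Khalil / Kokotović–Khalil–O'Reilly type, for the one-column Riccati slaving of
  `Literature.Analysis.ODE.SlowColumnSlaving`);
* `slavedLadder_pointwise`: along the ladder, `Φ' ≤ −2(Λ(d₀ + (1−ε) σ g(t)²) − μ₀) Φ`, `σ = s₋₁²/(d₋₁−d₀) + s₀²/(d₁−d₀)`
  (the second-order Taylor/slaving rate of the slow mode, realised up to the fraction `ε`), whenever
  `γ² = s₀² + s₋₁² ≤ β Δ ε σ` (weight of the fast remainder), the coupling is weak (`g_T²(4γ²/Δ + 2σ) ≤ Δ`) and with the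
  slack `μ₀ = 4βγ²(Λ g_T³ σ + g_D + Λ g_T²)²/(Λ Δ³)` (`|g| ≤ g_T`, `|g'| ≤ g_D` on the window);
* `slavedLadder_window`: the integrated form on a window `[t₀, t₁]` on which `g` is differentiable:
  `Φ(t) ≤ exp(−2Λ(d₀(t−t₀) + (1−ε)σ(G t − G t₀)) + 2μ₀(t−t₀))·Φ(t₀)` for any primitive `G` of `g²`.

All constants are `W`-free (uniform in the Galerkin truncation). The trapezoid slot (three affine pieces) and the
instantiation on the gauged out-of-plane / in-plane blocks of the cell problem are separate files.
-/

set_option linter.dupNamespace false -- layout D-0017: `AnomalousDissipation.AnomalousDissipation` repeats by design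

namespace Summit.AnomalousDissipation.AnomalousDissipation.Theorems.SolenoidalFractalHomogenisation.RealisedQuasiStaticCellLaw

noncomputable section

open Set Finset Complex
open scoped BigOperators ComplexConjugate

/-! ## §1 The pointwise inequality `Φ' ≤ −2λ Φ` -/

/-- **The slaved-ladder Lyapunov inequality, pointwise form.** Notation of the module docstring, at one instant: state
`x : ℤ → ℂ` vanishing off the window `W ∋ 0, ±1`, ladder field `Fv`, coupling value `gt` (`|gt| ≤ g_T`) with time
derivative `gdt` (`|gdt| ≤ g_D`), slaving profile `hf` and its time derivative `hd'`. Then the time derivative of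
`Φ = ‖x₀‖² + β Σ_{J≠0} ‖x_J − hf_J x₀‖²` along the ladder, namely
`2 Re(Fv₀ conj x₀) + β Σ_{J≠0} 2 Re((Fv_J − (hd'_J x₀ + hf_J Fv₀)) conj(x_J − hf_J x₀))`, is at most
`−2(Λ(d₀ + (1−ε)σ gt²) − μ₀)·Φ`. -/
theorem slavedLadder_pointwise (W : Finset ℤ) (h1 : (1 : ℤ) ∈ W) (hm1 : (-1 : ℤ) ∈ W)
    (d s : ℤ → ℝ) (Λ gT gD Δ γ σ ε β gt gdt : ℝ) (x Fv : ℤ → ℂ) (hf hd' : ℤ → ℝ)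
    (hs : ∀ J ∈ W, |s J| ≤ 1) (hγ : γ ^ 2 = s 0 ^ 2 + s (-1) ^ 2) (hγ0 : 0 ≤ γ)
    (hσ : σ = s (-1) ^ 2 / (d (-1) - d 0) + s 0 ^ 2 / (d 1 - d 0))
    (hΔ0 : 0 < Δ) (hΔ : ∀ J ∈ W, J ≠ 0 → d 0 + Δ ≤ d J) (hΛ : 0 < Λ) (hε : 0 ≤ ε) (hβ : 0 ≤ β)
    (hβγ : γ ^ 2 ≤ β * Δ * ε * σ) (hgt : |gt| ≤ gT) (hgdt : |gdt| ≤ gD)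
    (hsmall : gT ^ 2 * (4 * γ ^ 2 / Δ + 2 * σ) ≤ Δ)
    (hx : ∀ K, K ∉ W → x K = 0)
    (hFv : ∀ J, Fv J = -(Λ : ℂ) * ((d J : ℂ) * x J) -
      (gt : ℂ) * (Λ : ℂ) * ((s (J - 1) : ℂ) * x (J - 1) - (s J : ℂ) * x (J + 1)))
    (hhf : ∀ J, hf J = if J = 1 then -(gt * s 0 / (d 1 - d 0))
      else if J = -1 then gt * s (-1) / (d (-1) - d 0) else 0)
    (hhd : ∀ J, hd' J = if J = 1 then -(gdt * s 0 / (d 1 - d 0))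
      else if J = -1 then gdt * s (-1) / (d (-1) - d 0) else 0) :
    2 * (Fv 0 * conj (x 0)).re +
        β * ∑ J ∈ W.erase 0,
          2 * ((Fv J - ((hd' J : ℂ) * x 0 + (hf J : ℂ) * Fv 0)) * conj (x J - (hf J : ℂ) * x 0)).re +
      (2 * Λ * (d 0 + (1 - ε) * σ * gt ^ 2) -
          2 * (4 * β * γ ^ 2 * (Λ * gT ^ 3 * σ + gD + Λ * gT ^ 2) ^ 2 / (Λ * Δ ^ 3))) *
        (‖x 0‖ ^ 2 + β * ∑ J ∈ W.erase 0, ‖x J - (hf J : ℂ) * x 0‖ ^ 2) ≤ 0 := by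
  classical
  have hδp : Δ ≤ d 1 - d 0 := by linarith [hΔ 1 h1 (by norm_num)]
  have hδm : Δ ≤ d (-1) - d 0 := by linarith [hΔ (-1) hm1 (by norm_num)]
  have hδp0 : 0 < d 1 - d 0 := lt_of_lt_of_le hΔ0 hδp
  have hδm0 : 0 < d (-1) - d 0 := lt_of_lt_of_le hΔ0 hδm
  have hσ0 : 0 ≤ σ := by rw [hσ]; positivity
  have hgT0 : 0 ≤ gT := (abs_nonneg _).trans hgt
  have hgD0 : 0 ≤ gD := (abs_nonneg _).trans hgdt
  have hgt2 : gt ^ 2 ≤ gT ^ 2 := by rw [← sq_abs]; exact pow_le_pow_left₀ (abs_nonneg _) hgt 2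
  -- names: `F` (fast energy), `V = ‖x₀‖`, `Y = √F`, `cB` (defect size), `μ₀` (slack)
  obtain ⟨F, hFdef⟩ : ∃ F : ℝ, F = ∑ J ∈ W.erase 0, ‖x J - (hf J : ℂ) * x 0‖ ^ 2 := ⟨_, rfl⟩
  have hF0 : 0 ≤ F := by rw [hFdef]; exact Finset.sum_nonneg fun J _ => by positivity
  obtain ⟨V, hVdef⟩ : ∃ V : ℝ, V = ‖x 0‖ := ⟨_, rfl⟩
  have hV0 : 0 ≤ V := by rw [hVdef]; exact norm_nonneg _
  obtain ⟨Y, hYdef⟩ : ∃ Y : ℝ, Y = Real.sqrt F := ⟨_, rfl⟩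
  have hY0 : 0 ≤ Y := by rw [hYdef]; exact Real.sqrt_nonneg _
  have hYsq : Y ^ 2 = F := by rw [hYdef]; exact Real.sq_sqrt hF0
  obtain ⟨cB, hcBdef⟩ : ∃ cB : ℝ, cB = γ * (Λ * gT ^ 3 * σ + gD + Λ * gT ^ 2) / Δ := ⟨_, rfl⟩
  have hcB0 : 0 ≤ cB := by rw [hcBdef]; positivity
  obtain ⟨μ₀, hμ₀def⟩ : ∃ μ₀ : ℝ, μ₀ = 4 * β * γ ^ 2 * (Λ * gT ^ 3 * σ + gD + Λ * gT ^ 2) ^ 2 / (Λ * Δ ^ 3) :=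
    ⟨_, rfl⟩
  have hμ₀0 : 0 ≤ μ₀ := by rw [hμ₀def]; positivity
  have hμ₀cB : μ₀ * (Λ * Δ) = 4 * β * cB ^ 2 := by
    rw [hμ₀def, hcBdef]; field_simp
  -- the two bounds
  have hslow := slavedLadder_slow_le W h1 hm1 d s Λ γ σ gt x (Fv 0) hf hγ hγ0 hσ hΛ (hFv 0) hhf
  have hfast := slavedLadder_fast_le W h1 hm1 d s Λ gT gD Δ γ σ gt gdt x Fv hf hd' hs hγ hγ0 hσ hΔ0 hΔ hΛ
    hgt hgdt hx hFv hhf hhd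
  rw [← hFdef, ← hVdef, ← hYdef] at hslow
  rw [← hFdef, ← hVdef, ← hYdef, ← hcBdef] at hfast
  rw [← hFdef, ← hVdef, ← hμ₀def]
  have hAG1 : 2 * (|gt| * Λ * γ * V * Y) ≤ 2 * Λ * ε * σ * gt ^ 2 * V ^ 2 + β * Λ * Δ * Y ^ 2 / 2 := by
    refine two_mul_le_add_of_sq_le_mul (by positivity) (by positivity) ?_
    have e1 : (|gt| * Λ * γ * V * Y) ^ 2 = γ ^ 2 * (Λ ^ 2 * gt ^ 2 * V ^ 2 * Y ^ 2) := by
      rw [show (|gt| * Λ * γ * V * Y) ^ 2 = |gt| ^ 2 * Λ ^ 2 * γ ^ 2 * V ^ 2 * Y ^ 2 by ring, sq_abs]; ring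
    have e2 : 2 * Λ * ε * σ * gt ^ 2 * V ^ 2 * (β * Λ * Δ * Y ^ 2 / 2) =
        (β * Δ * ε * σ) * (Λ ^ 2 * gt ^ 2 * V ^ 2 * Y ^ 2) := by ring
    rw [e1, e2]
    exact mul_le_mul_of_nonneg_right hβγ (by positivity)
  -- AM–GM 2: the defect forcing against the slack `μ₀` and the other half of the fast dissipation
  have hAG2 : 2 * (2 * β * cB * V * Y) ≤ 2 * μ₀ * V ^ 2 + β * Λ * Δ * Y ^ 2 / 2 := by
    have hP : 0 ≤ 2 * μ₀ * V ^ 2 := mul_nonneg (mul_nonneg zero_le_two hμ₀0) (sq_nonneg V)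
    have hQ : 0 ≤ β * Λ * Δ * Y ^ 2 / 2 :=
      div_nonneg (mul_nonneg (mul_nonneg (mul_nonneg hβ hΛ.le) hΔ0.le) (sq_nonneg Y)) zero_le_two
    have hsq : (2 * β * cB * V * Y) ^ 2 ≤ 2 * μ₀ * V ^ 2 * (β * Λ * Δ * Y ^ 2 / 2) := by
      have e : 2 * μ₀ * V ^ 2 * (β * Λ * Δ * Y ^ 2 / 2) = (μ₀ * (Λ * Δ)) * β * V ^ 2 * Y ^ 2 := by ring
      rw [e, hμ₀cB]
      exact le_of_eq (by ring)
    exact two_mul_le_add_of_sq_le_mul hP hQ hsq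
  -- the `Y²`-coefficient is negative by the weak-coupling hypothesis
  have hYcoef : -2 * Λ * Δ + 4 * Λ * gT ^ 2 * γ ^ 2 / Δ + 2 * Λ * (1 - ε) * σ * gt ^ 2 ≤ -Λ * Δ := by
    have h1a : σ * gt ^ 2 ≤ σ * gT ^ 2 := mul_le_mul_of_nonneg_left hgt2 hσ0
    have h1b : (1 - ε) * (σ * gt ^ 2) ≤ 1 * (σ * gt ^ 2) :=
      mul_le_mul_of_nonneg_right (by linarith only [hε]) (mul_nonneg hσ0 (sq_nonneg gt))
    have h1 : 2 * Λ * ((1 - ε) * (σ * gt ^ 2)) ≤ 2 * Λ * (σ * gT ^ 2) :=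
      mul_le_mul_of_nonneg_left (by linarith only [h1a, h1b]) (by positivity)
    have h2 : Λ * (gT ^ 2 * (4 * γ ^ 2 / Δ + 2 * σ)) ≤ Λ * Δ := mul_le_mul_of_nonneg_left hsmall hΛ.le
    have e : 4 * Λ * gT ^ 2 * γ ^ 2 / Δ + 2 * Λ * (σ * gT ^ 2) = Λ * (gT ^ 2 * (4 * γ ^ 2 / Δ + 2 * σ)) := by
      ring
    have e2 : 2 * Λ * (1 - ε) * σ * gt ^ 2 = 2 * Λ * ((1 - ε) * (σ * gt ^ 2)) := by ring
    linarith only [h1, h2, e, e2]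
  -- assemble
  have hfast' := mul_le_mul_of_nonneg_left hfast hβ
  have hY2 : 0 ≤ β * F := by positivity
  rw [hYsq] at hAG1 hAG2
  have key : β * (-2 * Λ * (d 0 + Δ) * F + 4 * (V * Y * cB) + 4 * (Λ * gT ^ 2 * γ ^ 2 * F / Δ)) +
      (-2 * Λ * (d 0 + gt ^ 2 * σ) * V ^ 2 + 2 * (|gt| * Λ * γ * V * Y)) +
        (2 * Λ * (d 0 + (1 - ε) * σ * gt ^ 2) - 2 * μ₀) * (V ^ 2 + β * F) ≤ 0 := by
    have hY3 := mul_le_mul_of_nonneg_left hYcoef hY2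
    have hμF : 0 ≤ μ₀ * (β * F) := mul_nonneg hμ₀0 hY2
    have e : β * (-2 * Λ * (d 0 + Δ) * F + 4 * (V * Y * cB) + 4 * (Λ * gT ^ 2 * γ ^ 2 * F / Δ)) +
      (-2 * Λ * (d 0 + gt ^ 2 * σ) * V ^ 2 + 2 * (|gt| * Λ * γ * V * Y)) +
        (2 * Λ * (d 0 + (1 - ε) * σ * gt ^ 2) - 2 * μ₀) * (V ^ 2 + β * F) =
        (-(2 * Λ * ε * σ * gt ^ 2 * V ^ 2) - 2 * μ₀ * V ^ 2 + 2 * (|gt| * Λ * γ * V * Y) +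
            2 * (2 * β * cB * V * Y)) +
          β * F * (-2 * Λ * Δ + 4 * Λ * gT ^ 2 * γ ^ 2 / Δ + 2 * Λ * (1 - ε) * σ * gt ^ 2) -
            2 * (μ₀ * (β * F)) := by ring
    rw [e]
    linarith only [hAG1, hAG2, hY3, hμF]
  linarith only [key, hfast', hslow]


/-! ## §2 The integrated form on a window where the coupling is differentiable -/

/-- **The slaved-ladder Lyapunov functional: per-window contraction.** In the setting of
`ladderFunctional_decay_intWindow` (window `W ∋ 0, ±1`, links `|s_J| ≤ 1`, gap `d_J ≥ d₀ + Δ` off `0`, rate `Λ > 0`,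
state `v` vanishing off `W`, coordinatewise `HasDerivWithinAt` on `[t₀, t₁]`), but with a coupling `g` that is
differentiable within `[t₀, t₁]` (`|g| ≤ g_T`, `|g'| ≤ g_D`) and WEAK (`g_T²(4γ²/Δ + 2σ) ≤ Δ`), and a weight `β ≥ 0` with
`γ² ≤ βΔεσ`: for every primitive `G` of `g²` on the window and every `t ∈ [t₀, t₁]`,
`Φ(t) ≤ exp(−2Λ(d₀(t−t₀) + (1−ε)σ(G t − G t₀)) + 2μ₀(t−t₀))·Φ(t₀)`,
`Φ(t) = ‖v₀(t)‖² + β Σ_{J∈W∖0} ‖v_J(t) − h_J(t)v₀(t)‖²`, `μ₀ = 4βγ²(Λg_T³σ + g_D + Λg_T²)²/(ΛΔ³)`. The exponent carries the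
full second-order Taylor rate `σ∫g²` of the window up to the fraction `ε`; the overhead sits in the weight `β`, once. -/
theorem slavedLadder_window (W : Finset ℤ) (h0 : (0 : ℤ) ∈ W) (h1 : (1 : ℤ) ∈ W) (hm1 : (-1 : ℤ) ∈ W)
    (d s : ℤ → ℝ) (Λ gT gD Δ γ σ ε β t₀ t₁ : ℝ) (g g' G : ℝ → ℝ) (v : ℝ → ℤ → ℂ)
    (hs : ∀ J ∈ W, |s J| ≤ 1) (hγ : γ ^ 2 = s 0 ^ 2 + s (-1) ^ 2) (hγ0 : 0 ≤ γ)
    (hσ : σ = s (-1) ^ 2 / (d (-1) - d 0) + s 0 ^ 2 / (d 1 - d 0))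
    (hΔ0 : 0 < Δ) (hΔ : ∀ J ∈ W, J ≠ 0 → d 0 + Δ ≤ d J) (hΛ : 0 < Λ) (hε : 0 ≤ ε) (hβ : 0 ≤ β)
    (hβγ : γ ^ 2 ≤ β * Δ * ε * σ)
    (hgT : ∀ t ∈ Icc t₀ t₁, |g t| ≤ gT) (hgD : ∀ t ∈ Icc t₀ t₁, |g' t| ≤ gD)
    (hg : ∀ t ∈ Icc t₀ t₁, HasDerivWithinAt g (g' t) (Icc t₀ t₁) t)
    (hG : ∀ t ∈ Icc t₀ t₁, HasDerivWithinAt G (g t ^ 2) (Icc t₀ t₁) t)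
    (hsmall : gT ^ 2 * (4 * γ ^ 2 / Δ + 2 * σ) ≤ Δ)
    (hsupp : ∀ t ∈ Icc t₀ t₁, ∀ J, J ∉ W → v t J = 0)
    (hderiv : ∀ t ∈ Icc t₀ t₁, ∀ J ∈ W, HasDerivWithinAt (fun τ => v τ J)
        (-(Λ : ℂ) * ((d J : ℂ) * v t J) -
          (g t : ℂ) * (Λ : ℂ) * ((s (J - 1) : ℂ) * v t (J - 1) - (s J : ℂ) * v t (J + 1))) (Icc t₀ t₁) t) :
    ∀ t ∈ Icc t₀ t₁,
      ‖v t 0‖ ^ 2 + β * ∑ J ∈ W.erase 0,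
          ‖v t J - ((if J = 1 then -(g t * s 0 / (d 1 - d 0))
              else if J = -1 then g t * s (-1) / (d (-1) - d 0) else 0 : ℝ) : ℂ) * v t 0‖ ^ 2 ≤
        Real.exp (-(2 * Λ * (d 0 * (t - t₀) + (1 - ε) * σ * (G t - G t₀))) +
            2 * (4 * β * γ ^ 2 * (Λ * gT ^ 3 * σ + gD + Λ * gT ^ 2) ^ 2 / (Λ * Δ ^ 3)) * (t - t₀)) *
          (‖v t₀ 0‖ ^ 2 + β * ∑ J ∈ W.erase 0,
            ‖v t₀ J - ((if J = 1 then -(g t₀ * s 0 / (d 1 - d 0))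
                else if J = -1 then g t₀ * s (-1) / (d (-1) - d 0) else 0 : ℝ) : ℂ) * v t₀ 0‖ ^ 2) := by
  classical
  -- names for the profile, its time derivative, the field, the functional, the slack and the exponent
  obtain ⟨hf, hhf⟩ : ∃ hf : ℝ → ℤ → ℝ, hf = fun τ J => if J = 1 then -(g τ * s 0 / (d 1 - d 0))
      else if J = -1 then g τ * s (-1) / (d (-1) - d 0) else 0 := ⟨_, rfl⟩
  obtain ⟨hd', hhd⟩ : ∃ hd' : ℝ → ℤ → ℝ, hd' = fun τ J => if J = 1 then -(g' τ * s 0 / (d 1 - d 0))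
      else if J = -1 then g' τ * s (-1) / (d (-1) - d 0) else 0 := ⟨_, rfl⟩
  obtain ⟨Fv, hFv⟩ : ∃ Fv : ℝ → ℤ → ℂ, Fv = fun τ J => -(Λ : ℂ) * ((d J : ℂ) * v τ J) -
      (g τ : ℂ) * (Λ : ℂ) * ((s (J - 1) : ℂ) * v τ (J - 1) - (s J : ℂ) * v τ (J + 1)) := ⟨_, rfl⟩
  obtain ⟨Φ, hΦ⟩ : ∃ Φ : ℝ → ℝ, Φ = fun τ =>
      ‖v τ 0‖ ^ 2 + β * ∑ J ∈ W.erase 0, ‖v τ J - ((hf τ J : ℝ) : ℂ) * v τ 0‖ ^ 2 := ⟨_, rfl⟩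
  obtain ⟨μ₀, hμ₀⟩ : ∃ μ₀ : ℝ, μ₀ = 4 * β * γ ^ 2 * (Λ * gT ^ 3 * σ + gD + Λ * gT ^ 2) ^ 2 / (Λ * Δ ^ 3) :=
    ⟨_, rfl⟩
  obtain ⟨Ex, hEx⟩ : ∃ Ex : ℝ → ℝ, Ex = fun τ =>
      2 * Λ * (d 0 * (τ - t₀) + (1 - ε) * σ * (G τ - G t₀)) - 2 * μ₀ * (τ - t₀) := ⟨_, rfl⟩
  obtain ⟨D, hD⟩ : ∃ D : ℝ → ℝ, D = fun τ => 2 * (Fv τ 0 * conj (v τ 0)).re + β * ∑ J ∈ W.erase 0,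
      2 * ((Fv τ J - (((hd' τ J : ℝ) : ℂ) * v τ 0 + ((hf τ J : ℝ) : ℂ) * Fv τ 0)) *
        conj (v τ J - ((hf τ J : ℝ) : ℂ) * v τ 0)).re := ⟨_, rfl⟩
  -- Step 1: `Φ' = D` within the window
  have hΦderiv : ∀ τ ∈ Icc t₀ t₁, HasDerivWithinAt Φ (D τ) (Icc t₀ t₁) τ := by
    intro τ hτ
    have hvJ : ∀ J ∈ W, HasDerivWithinAt (fun τ' => v τ' J) (Fv τ J) (Icc t₀ t₁) τ := fun J hJ => by
      rw [hFv]; exact hderiv τ hτ J hJ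
    have hhfJ : ∀ J, HasDerivWithinAt (fun τ' => ((hf τ' J : ℝ) : ℂ)) ((hd' τ J : ℝ) : ℂ) (Icc t₀ t₁) τ := by
      intro J
      by_cases hJ1 : J = 1
      · subst hJ1
        have e1 : (fun τ' => ((hf τ' 1 : ℝ) : ℂ)) = fun τ' => (((-(g τ' * s 0 / (d 1 - d 0))) : ℝ) : ℂ) := by
          funext τ'; rw [hhf]; simp
        have e2 : hd' τ 1 = -(g' τ * s 0 / (d 1 - d 0)) := by rw [hhd]; simp
        rw [e1, e2]
        exact (((hg τ hτ).mul_const (s 0)).div_const (d 1 - d 0)).neg.ofReal_comp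
      · by_cases hJm1 : J = -1
        · subst hJm1
          have e1 : (fun τ' => ((hf τ' (-1) : ℝ) : ℂ)) = fun τ' => (((g τ' * s (-1) / (d (-1) - d 0)) : ℝ) : ℂ) := by
            funext τ'; rw [hhf]; norm_num
          have e2 : hd' τ (-1) = g' τ * s (-1) / (d (-1) - d 0) := by rw [hhd]; norm_num
          rw [e1, e2]
          exact (((hg τ hτ).mul_const (s (-1))).div_const (d (-1) - d 0)).ofReal_comp
        · have e1 : (fun τ' => ((hf τ' J : ℝ) : ℂ)) = fun _ => (0 : ℂ) := by
            funext τ'; rw [hhf]; simp [hJ1, hJm1]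
          have e2 : hd' τ J = 0 := by rw [hhd]; simp [hJ1, hJm1]
          rw [e1, e2, Complex.ofReal_zero]
          exact hasDerivWithinAt_const τ (Icc t₀ t₁) (0 : ℂ)
    have hrJ : ∀ J ∈ W.erase 0, HasDerivWithinAt (fun τ' => ‖v τ' J - ((hf τ' J : ℝ) : ℂ) * v τ' 0‖ ^ 2)
        (2 * ((Fv τ J - (((hd' τ J : ℝ) : ℂ) * v τ 0 + ((hf τ J : ℝ) : ℂ) * Fv τ 0)) *
          conj (v τ J - ((hf τ J : ℝ) : ℂ) * v τ 0)).re) (Icc t₀ t₁) τ := by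
      intro J hJ
      have h := ((hvJ J (Finset.mem_of_mem_erase hJ)).sub ((hhfJ J).mul (hvJ 0 h0))).norm_sq
      simp only [Complex.inner] at h
      exact h
    have h0' : HasDerivWithinAt (fun τ' => ‖v τ' 0‖ ^ 2) (2 * (Fv τ 0 * conj (v τ 0)).re) (Icc t₀ t₁) τ := by
      have h := (hvJ 0 h0).norm_sq
      simp only [Complex.inner] at h
      exact h
    have hsum := (HasDerivWithinAt.fun_sum hrJ).const_mul β
    have htot := h0'.add hsum
    rw [hΦ, hD]
    exact htot
  -- Step 2: `D + Ex'·Φ ≤ 0` pointwise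
  have hpoint : ∀ τ ∈ Icc t₀ t₁, D τ + (2 * Λ * (d 0 + (1 - ε) * σ * g τ ^ 2) - 2 * μ₀) * Φ τ ≤ 0 := by
    intro τ hτ
    have h := slavedLadder_pointwise W h1 hm1 d s Λ gT gD Δ γ σ ε β (g τ) (g' τ) (v τ) (Fv τ) (hf τ) (hd' τ)
      hs hγ hγ0 hσ hΔ0 hΔ hΛ hε hβ hβγ (hgT τ hτ) (hgD τ hτ) hsmall (hsupp τ hτ)
      (fun J => by rw [hFv]) (fun J => by rw [hhf]) (fun J => by rw [hhd])
    rw [hD, hΦ, hμ₀]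
    exact h
  -- Step 3: `Ψ = exp(Ex)·Φ` is non-increasing on the window
  have hExderiv : ∀ τ ∈ Icc t₀ t₁, HasDerivWithinAt Ex
      (2 * Λ * (d 0 + (1 - ε) * σ * g τ ^ 2) - 2 * μ₀) (Icc t₀ t₁) τ := by
    intro τ hτ
    have h1 : HasDerivWithinAt (fun τ' => τ' - t₀) 1 (Icc t₀ t₁) τ := (hasDerivWithinAt_id τ _).sub_const t₀
    have h2 : HasDerivWithinAt (fun τ' => G τ' - G t₀) (g τ ^ 2) (Icc t₀ t₁) τ := (hG τ hτ).sub_const (G t₀)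
    have h3 := (((h1.const_mul (d 0)).add (h2.const_mul ((1 - ε) * σ))).const_mul (2 * Λ)).sub
      (h1.const_mul (2 * μ₀))
    rw [hEx]
    exact h3.congr_deriv (by ring)
  have hΨderiv : ∀ τ ∈ Icc t₀ t₁, HasDerivWithinAt (fun τ' => Real.exp (Ex τ') * Φ τ')
      (Real.exp (Ex τ) * (2 * Λ * (d 0 + (1 - ε) * σ * g τ ^ 2) - 2 * μ₀) * Φ τ + Real.exp (Ex τ) * D τ)
      (Icc t₀ t₁) τ := fun τ hτ => ((hExderiv τ hτ).exp).mul (hΦderiv τ hτ)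
  have hΨanti : AntitoneOn (fun τ' => Real.exp (Ex τ') * Φ τ') (Icc t₀ t₁) := by
    refine antitoneOn_of_hasDerivWithinAt_nonpos (convex_Icc t₀ t₁)
      (f' := fun τ => Real.exp (Ex τ) * (2 * Λ * (d 0 + (1 - ε) * σ * g τ ^ 2) - 2 * μ₀) * Φ τ +
        Real.exp (Ex τ) * D τ)
      (fun τ hτ => (hΨderiv τ hτ).continuousWithinAt) (fun τ hτ => ?_) (fun τ hτ => ?_)
    · rw [interior_Icc] at hτ
      exact ((hΨderiv τ (Ioo_subset_Icc_self hτ)).mono (interior_subset)).mono_of_mem_nhdsWithin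
        (by rw [interior_Icc]; exact self_mem_nhdsWithin)
    · rw [interior_Icc] at hτ
      have hτ' := Ioo_subset_Icc_self hτ
      have e : Real.exp (Ex τ) * (2 * Λ * (d 0 + (1 - ε) * σ * g τ ^ 2) - 2 * μ₀) * Φ τ + Real.exp (Ex τ) * D τ =
          Real.exp (Ex τ) * (D τ + (2 * Λ * (d 0 + (1 - ε) * σ * g τ ^ 2) - 2 * μ₀) * Φ τ) := by ring
      rw [e]
      exact mul_nonpos_of_nonneg_of_nonpos (Real.exp_pos _).le (hpoint τ hτ')
  -- conclusion
  intro t ht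
  have ht₀ : t₀ ∈ Icc t₀ t₁ := ⟨le_rfl, ht.1.trans ht.2⟩
  have hmono := hΨanti ht₀ ht ht.1
  simp only at hmono
  have hEx0 : Ex t₀ = 0 := by rw [hEx]; simp
  rw [hEx0, Real.exp_zero, one_mul] at hmono
  -- `Φ t ≤ exp(−Ex t) Φ t₀`
  have hΦt : Φ t ≤ Real.exp (-Ex t) * Φ t₀ := by
    have hpos := Real.exp_pos (-Ex t)
    have := mul_le_mul_of_nonneg_left hmono hpos.le
    rwa [← mul_assoc, ← Real.exp_add, neg_add_cancel, Real.exp_zero, one_mul] at this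
  have eΦ : ∀ τ, Φ τ = ‖v τ 0‖ ^ 2 + β * ∑ J ∈ W.erase 0,
      ‖v τ J - ((if J = 1 then -(g τ * s 0 / (d 1 - d 0))
          else if J = -1 then g τ * s (-1) / (d (-1) - d 0) else 0 : ℝ) : ℂ) * v τ 0‖ ^ 2 := by
    intro τ; rw [hΦ, hhf]
  have eEx : -Ex t = -(2 * Λ * (d 0 * (t - t₀) + (1 - ε) * σ * (G t - G t₀))) +
      2 * (4 * β * γ ^ 2 * (Λ * gT ^ 3 * σ + gD + Λ * gT ^ 2) ^ 2 / (Λ * Δ ^ 3)) * (t - t₀) := by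
    rw [hEx, hμ₀]; ring
  rw [← eΦ t, ← eΦ t₀, ← eEx]
  exact hΦt

end

end Summit.AnomalousDissipation.AnomalousDissipation.Theorems.SolenoidalFractalHomogenisation.RealisedQuasiStaticCellLaw
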